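import Summits.BirchSwinnertonDyer.Rank1Residual.WAll.AltClosersGlueAtThreeCells
import Summits.BirchSwinnertonDyer.Rank1Residual.WAll.TargetAdditiveAtThreePotSSIrrAtoms
import Summits.BirchSwinnertonDyer.Rank1Residual.O6.X4CongruenceAnchor
import HarnessLib

/-!
# Rung W-ALL (D-0120): ALT-CLOSERS BY NAME for the cells of row 2 @3 WILD (`WAllExclAddWildRankOne`)
# cut out by route `UniversalToricDescent` (seat `bsd-wall-pss3`) — the semistable-TWIN cell and its
# residual `WildRankOneOffCellAtThree` (item 20388); the registry with the wild leaf split by rank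
# (cell `bsd-wall`, lane 2, seat ty-2 g5)

HONEST FRAMING (cell `bsd-wall`, run/shared/lean/pub/bsd-wall/; WALL-BRIEF-v1 §2; companion of
`WAll/AltClosersGlueAtThreeCells.lean` (row 2 @3 by census cell from the rung leaves; p506587 / p508598)
and of `WAll/AltClosersResidualCells*.lean`, same rules: NOTHING ASSERTED, no `def`, no `@[conjecture]`,
no named fact, NO ROUTE FILE IMPORTED — the route's item shapes are re-typed VERBATIM).

THE ROUTE (`route-BirchSwinnertonDyer-UniversalToricDescent`, pss3 g0, OPENED 2026-08-27T08:24Z, draft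
pending tribunal; closes-target = the REGISTERED slice leaf `Summit.BirchSwinnertonDyer.WAllExclAddWildRankOne`
— non-CM `E/ℚ` wild at `3` (`Additive.ClassO6 W 3`, `e ∈ {3,6,12}`), `r_an = 1` ⇒ `BSD(E,3)`, 13 573
classes): the lever transports an anticyclotomic BDP equality through the universal deformation space
of `ρ̄ = E[3]` (onto) from a SEMISTABLE-AT-3 TWIN `E′` (`E′[3] ≅ E[3]` as Galois modules, `E′` not
additive at `3`, `ρ̄_{E′,3}` onto). Its residual items: 20387 `WildRankZeroTwistAtThree` = the leaf
`WAllExclAddWildRankZero` BY NAME (nothing to re-type), and **20388 `WildRankOneOffCellAtThree`** =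
the wild rank-one rows OFF the attacked cell:
`¬CM → ClassO6 W 3 → r_an = 1 → ¬(ρ̄_{E,3} onto ∧ ∃ twin E′: ModPCongruent E′ E 3 ∧ ¬Addv E′ 3 ∧ ρ̄_{E′,3} onto) → BSDp W 3`
(mass of record: 9 376 reducible + 303 irreducible non-onto + the twinless onto classes, uncensused).

* §1 item 20388 BY NAME: `wildRankOneOffCellAtThree_of_wAllExclAddWildRankOne` (it is a slice of the
  target: exact), `wildRankOneOffCellAtThree_of_o6Sharp` (⇐ LEAF K9-wild `Additive.O6Sharp` + GZK),
  and at SUB-CLASS granularity `wildRankOneOffCellAtThree_of_red_of_irrNotSurj_of_twinlessOnto`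
  (⇐ ty-1's atoms `WAllExclAddWildRankOneRed` (9 376) + `WAllExclAddWildRankOneIrrNotSurj` (303) + the
  TWINLESS-ONTO cell in `BSD(E,3)` currency); `wildRankZeroTwistAtThree_of_o6Sharp` (20387 ⇐ K9w).
* §2 the TWIN cell (the route's purchase, `BSD(E,3)` currency) and the reassembly the route's `closes`
  performs modulo its cruxes: `wAllExclAddWildRankOne_of_twinCell_of_offCell` (+ exact converse
  `twinCell_offCell_of_wAllExclAddWildRankOne`), `wAllExclAddWild_of_twinCell_of_offCell_of_rankZero`.
* §3 THE REGISTRY with row 2 @3 wild SPLIT BY RANK (`WAllExclAddWildRankZero` = 20387's leaf,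
  `WAllExclAddWildRankOne` = the route's target): `wAllExclusions_of_cellRankSliceLeaves`,
  `wAll_of_cellRankSliceLeaves_primaryGZ` (23 leaf/cell/slice/target/residual hyps + `hW` + FIFTEEN
  named facts), `wAllFormula_of_cellRankSliceLeaves_primaryGZ` (+ `hL0`).

No census number moves; typed ≠ proved ≠ endorsed; BSD is not proved by any of this.

References: `WAll/TargetAdditiveAtThreeCells.lean` (`WAllExclAddWildRank{Zero,One}`, `wAllExclAddWild_iff_ranks`),
`WAll/TargetAdditiveAtThreePotSSImage.lean` / `…IrrAtoms.lean` (ty-1 g5: the image atoms),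
`Rank1Residual/O6/X4CongruenceAnchor.lean` (`O6.ModPCongruent`), `WAll/AltClosersGlueAtThreeCells.lean`;
`ledger route show route-BirchSwinnertonDyer-UniversalToricDescent` rev 1; [cite: Miller2011LMS, §1 and Def. 1.1];
[cite: Serre1972, §4 (the mod-`p` representation; shape only)].
-/

noncomputable section

open scoped Classical

open WeierstrassCurve Literature.NumberTheory.EllipticCurves
  Literature.NumberTheory.EllipticCurves.Rank1Residual
  Literature.NumberTheory.EllipticCurves.Rank1Residual.Typed
  Literature.NumberTheory.EllipticCurves.Wuthrich2014
  Literature.NumberTheory.EllipticCurves.ModularForms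

set_option autoImplicit false

namespace Summit.BirchSwinnertonDyer.Rank1Residual.WAll

open Summit.BirchSwinnertonDyer
open Summit.BirchSwinnertonDyer.BirchSwinnertonDyer.Rank1Residual (NonCMAtTwo BSDpOnClassX9)

/-! ## §1 Item 20388 `WildRankOneOffCellAtThree` (verbatim) BY NAME -/

/-- **Item 20388 ⇐ the target leaf `WAllExclAddWildRankOne`** — the residual is the target RESTRICTED
off the twin cell (exact; registering it adds nothing beyond the leaf). [folklore] -/
theorem wildRankOneOffCellAtThree_of_wAllExclAddWildRankOne (h : WAllExclAddWildRankOne) :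
    ∀ (W : WeierstrassCurve ℚ) [W.IsElliptic] [W.IsGloballyMinimal], ¬ W.HasCM →
      Additive.ClassO6 W 3 → W.analyticRank = 1 →
      ¬ (W.HasSurjectiveModNGaloisRep 3 ∧
          ∃ (W' : WeierstrassCurve ℚ) (_ : W'.IsElliptic) (_ : W'.IsGloballyMinimal),
            O6.ModPCongruent W' W 3 ∧ ¬ Addv W' 3 ∧ W'.HasSurjectiveModNGaloisRep 3) →
      BSDp W 3 :=
  fun W _ _ hcm hO hr _ ↦ h W hcm hO hr

/-- **Item 20388 ⇐ LEAF K9-wild `Additive.O6Sharp` + GZK** (the sharp wild leaf closes every wild row in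
rank `≤ 1`, `wAllExclAddWildRanks_of_o6Sharp`). [folklore] -/
theorem wildRankOneOffCellAtThree_of_o6Sharp (hK9w : Additive.O6Sharp)
    (hGZK : rank_eq_analyticRank_of_analyticRank_le_one) :
    ∀ (W : WeierstrassCurve ℚ) [W.IsElliptic] [W.IsGloballyMinimal], ¬ W.HasCM →
      Additive.ClassO6 W 3 → W.analyticRank = 1 →
      ¬ (W.HasSurjectiveModNGaloisRep 3 ∧
          ∃ (W' : WeierstrassCurve ℚ) (_ : W'.IsElliptic) (_ : W'.IsGloballyMinimal),
            O6.ModPCongruent W' W 3 ∧ ¬ Addv W' 3 ∧ W'.HasSurjectiveModNGaloisRep 3) →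
      BSDp W 3 :=
  wildRankOneOffCellAtThree_of_wAllExclAddWildRankOne (wAllExclAddWildRanks_of_o6Sharp hK9w hGZK).2

/-- **Item 20387 `WildRankZeroTwistAtThree` (= the leaf `WAllExclAddWildRankZero` by name) ⇐ LEAF
K9-wild + GZK.** [folklore] -/
theorem wildRankZeroTwistAtThree_of_o6Sharp (hK9w : Additive.O6Sharp)
    (hGZK : rank_eq_analyticRank_of_analyticRank_le_one) : WAllExclAddWildRankZero :=
  (wAllExclAddWildRanks_of_o6Sharp hK9w hGZK).1

/-- **Item 20388 at SUB-CLASS granularity ⇐ the reducible atom + the irreducible-non-onto atom + the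
TWINLESS-ONTO cell.** Off the twin cell a wild rank-one class is reducible (`WAllExclAddWildRankOneRed`,
9 376 classes of record), or irreducible not onto (`WAllExclAddWildRankOneIrrNotSurj`, 303), or onto
WITHOUT a semistable onto twin (the cell `hT`, `BSD(E,3)` currency; uncensused). Case split on
`Surj W 3` / `Irr W 3` (`Red W 3` is `¬ Irr W 3` by `rfl`). [folklore] -/
theorem wildRankOneOffCellAtThree_of_red_of_irrNotSurj_of_twinlessOnto
    (hR : WAllExclAddWildRankOneRed) (hN : WAllExclAddWildRankOneIrrNotSurj)
    (hT : ∀ (W : WeierstrassCurve ℚ) [W.IsElliptic] [W.IsGloballyMinimal], ¬ W.HasCM →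
      Additive.ClassO6 W 3 → W.HasSurjectiveModNGaloisRep 3 →
      ¬ (∃ (W' : WeierstrassCurve ℚ) (_ : W'.IsElliptic) (_ : W'.IsGloballyMinimal),
            O6.ModPCongruent W' W 3 ∧ ¬ Addv W' 3 ∧ W'.HasSurjectiveModNGaloisRep 3) →
      W.analyticRank = 1 → BSDp W 3) :
    ∀ (W : WeierstrassCurve ℚ) [W.IsElliptic] [W.IsGloballyMinimal], ¬ W.HasCM →
      Additive.ClassO6 W 3 → W.analyticRank = 1 →
      ¬ (W.HasSurjectiveModNGaloisRep 3 ∧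
          ∃ (W' : WeierstrassCurve ℚ) (_ : W'.IsElliptic) (_ : W'.IsGloballyMinimal),
            O6.ModPCongruent W' W 3 ∧ ¬ Addv W' 3 ∧ W'.HasSurjectiveModNGaloisRep 3) →
      BSDp W 3 := by
  intro W _ _ hcm hO hr hoff
  by_cases hs : Surj W 3
  · exact hT W hcm hO hs (fun htw ↦ hoff ⟨hs, htw⟩) hr
  · by_cases hi : Irr W 3
    · exact hN W hcm hO hi hs hr
    · exact hR W hcm hO hi hr

/-! ## §2 The TWIN cell (the route's purchase) and the reassembly of the target -/

/-- **`WAllExclAddWildRankOne` ⇐ the TWIN cell in `BSD(E,3)` currency + item 20388** — the shape of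
route `UniversalToricDescent`'s `closes` modulo its cruxes (toric transport, twin IMC, Waldspurger,
control, kernel buy `BSD(E,3)` on the twin cell; the residual carries the complement). [folklore] -/
theorem wAllExclAddWildRankOne_of_twinCell_of_offCell
    (hTwin : ∀ (W : WeierstrassCurve ℚ) [W.IsElliptic] [W.IsGloballyMinimal], ¬ W.HasCM →
      Additive.ClassO6 W 3 → W.analyticRank = 1 →
      (W.HasSurjectiveModNGaloisRep 3 ∧
          ∃ (W' : WeierstrassCurve ℚ) (_ : W'.IsElliptic) (_ : W'.IsGloballyMinimal),
            O6.ModPCongruent W' W 3 ∧ ¬ Addv W' 3 ∧ W'.HasSurjectiveModNGaloisRep 3) →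
      BSDp W 3)
    (hOff : ∀ (W : WeierstrassCurve ℚ) [W.IsElliptic] [W.IsGloballyMinimal], ¬ W.HasCM →
      Additive.ClassO6 W 3 → W.analyticRank = 1 →
      ¬ (W.HasSurjectiveModNGaloisRep 3 ∧
          ∃ (W' : WeierstrassCurve ℚ) (_ : W'.IsElliptic) (_ : W'.IsGloballyMinimal),
            O6.ModPCongruent W' W 3 ∧ ¬ Addv W' 3 ∧ W'.HasSurjectiveModNGaloisRep 3) →
      BSDp W 3) :
    WAllExclAddWildRankOne := by
  intro W _ _ hcm hO hr
  by_cases hc : (W.HasSurjectiveModNGaloisRep 3 ∧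
      ∃ (W' : WeierstrassCurve ℚ) (_ : W'.IsElliptic) (_ : W'.IsGloballyMinimal),
        O6.ModPCongruent W' W 3 ∧ ¬ Addv W' 3 ∧ W'.HasSurjectiveModNGaloisRep 3)
  · exact hTwin W hcm hO hr hc
  · exact hOff W hcm hO hr hc

/-- **Exactness of the twin split**: both cells follow from `WAllExclAddWildRankOne`. [folklore] -/
theorem twinCell_offCell_of_wAllExclAddWildRankOne (h : WAllExclAddWildRankOne) :
    (∀ (W : WeierstrassCurve ℚ) [W.IsElliptic] [W.IsGloballyMinimal], ¬ W.HasCM →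
      Additive.ClassO6 W 3 → W.analyticRank = 1 →
      (W.HasSurjectiveModNGaloisRep 3 ∧
          ∃ (W' : WeierstrassCurve ℚ) (_ : W'.IsElliptic) (_ : W'.IsGloballyMinimal),
            O6.ModPCongruent W' W 3 ∧ ¬ Addv W' 3 ∧ W'.HasSurjectiveModNGaloisRep 3) →
      BSDp W 3) ∧
    (∀ (W : WeierstrassCurve ℚ) [W.IsElliptic] [W.IsGloballyMinimal], ¬ W.HasCM →
      Additive.ClassO6 W 3 → W.analyticRank = 1 →
      ¬ (W.HasSurjectiveModNGaloisRep 3 ∧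
          ∃ (W' : WeierstrassCurve ℚ) (_ : W'.IsElliptic) (_ : W'.IsGloballyMinimal),
            O6.ModPCongruent W' W 3 ∧ ¬ Addv W' 3 ∧ W'.HasSurjectiveModNGaloisRep 3) →
      BSDp W 3) :=
  ⟨fun W _ _ hcm hO hr _ ↦ h W hcm hO hr, wildRankOneOffCellAtThree_of_wAllExclAddWildRankOne h⟩

/-- **The whole wild cell `WAllExclAddWild` (row 2 @3, O6, rank `≤ 1`) ⇐ the TWIN cell + item 20388
+ item 20387's leaf `WAllExclAddWildRankZero`** (`wAllExclAddWild_iff_ranks`). [folklore] -/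
theorem wAllExclAddWild_of_twinCell_of_offCell_of_rankZero
    (hTwin : ∀ (W : WeierstrassCurve ℚ) [W.IsElliptic] [W.IsGloballyMinimal], ¬ W.HasCM →
      Additive.ClassO6 W 3 → W.analyticRank = 1 →
      (W.HasSurjectiveModNGaloisRep 3 ∧
          ∃ (W' : WeierstrassCurve ℚ) (_ : W'.IsElliptic) (_ : W'.IsGloballyMinimal),
            O6.ModPCongruent W' W 3 ∧ ¬ Addv W' 3 ∧ W'.HasSurjectiveModNGaloisRep 3) →
      BSDp W 3)
    (hOff : ∀ (W : WeierstrassCurve ℚ) [W.IsElliptic] [W.IsGloballyMinimal], ¬ W.HasCM →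
      Additive.ClassO6 W 3 → W.analyticRank = 1 →
      ¬ (W.HasSurjectiveModNGaloisRep 3 ∧
          ∃ (W' : WeierstrassCurve ℚ) (_ : W'.IsElliptic) (_ : W'.IsGloballyMinimal),
            O6.ModPCongruent W' W 3 ∧ ¬ Addv W' 3 ∧ W'.HasSurjectiveModNGaloisRep 3) →
      BSDp W 3)
    (h0 : WAllExclAddWildRankZero) : WAllExclAddWild :=
  wAllExclAddWild_iff_ranks.mpr ⟨h0, wAllExclAddWildRankOne_of_twinCell_of_offCell hTwin hOff⟩

/-! ## §3 The registry with row 2 @3 wild SPLIT BY RANK -/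

/-- **THE CLOSED LIST with the wild cell split by rank**: as `wAllExclusions_of_cellSliceLeaves` with
`hWild : WAllExclAddWild` replaced by `WAllExclAddWildRankZero` (item 20387's leaf; rung K9 / W2
territory) and `WAllExclAddWildRankOne` (route `UniversalToricDescent`'s registered closes-target).
[folklore] -/
theorem wAllExclusions_of_cellRankSliceLeaves (h5 : NonCMAtTwo)
    (hM3 : WAllExclAddPotMultAtThree) (hG3 : WAllExclAddPotOrdAtThree)
    (hT3 : WAllExclAddTameSSAtThree) (hW0 : WAllExclAddWildRankZero) (hW1 : WAllExclAddWildRankOne)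
    (h50 : WAllExclAdditiveFiveLeRankZero) (h51 : WAllExclAdditiveFiveLeRankOne)
    (hK2a : X11b.MultiplicativeRankOne) (hK2b : X11b.MultiplicativeRankOneAtThree)
    (hK5 : Eisenstein.EisensteinPrimes) (hK3 : Supersingular.SignedSupersingular)
    (h73 : WAllCornerX7AtThree) (h75 : WAllCornerX7FiveLe)
    (hK6 : BSDpOnClassX9) (hX10b : X10.BSDpOnClassX10b) (hX11a : X11a.Target)
    (hF3 : WAllCornerFInertBadAtThree) (hF5 : WAllCornerFInertBadFiveLe)
    (hF2 : WAllCornerFTwo) (hFr : WAllCornerFRamified)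
    (hW : sha_dvd_analyticSha) (hmod : hasEntireLFunction_rat)
    (hGZK : rank_eq_analyticRank_of_analyticRank_le_one) : WAllExclusions :=
  wAllExclusions_of_cellSliceLeaves h5 hM3 hG3 hT3 (wAllExclAddWild_iff_ranks.mpr ⟨hW0, hW1⟩) h50 h51
    hK2a hK2b hK5 hK3 h73 h75 hK6 hX10b hX11a hF3 hF5 hF2 hFr hW hmod hGZK

/-- **W-ALL with the wild cell split by rank, FIFTEEN named facts, the Gross–Zagier side primary**
(`wAll_of_exclusions_primaryGZ ∘ wAllExclusions_of_cellRankSliceLeaves`; `hmod` derived, `hGZK` fed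
from its road of record). [cite: Darmon2004, Thm. 3.22 and §3.9] -/
theorem wAll_of_cellRankSliceLeaves_primaryGZ (h5 : NonCMAtTwo)
    (hM3 : WAllExclAddPotMultAtThree) (hG3 : WAllExclAddPotOrdAtThree)
    (hT3 : WAllExclAddTameSSAtThree) (hW0 : WAllExclAddWildRankZero) (hW1 : WAllExclAddWildRankOne)
    (h50 : WAllExclAdditiveFiveLeRankZero) (h51 : WAllExclAdditiveFiveLeRankOne)
    (hK2a : X11b.MultiplicativeRankOne) (hK2b : X11b.MultiplicativeRankOneAtThree)
    (hK5 : Eisenstein.EisensteinPrimes) (hK3 : Supersingular.SignedSupersingular)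
    (h73 : WAllCornerX7AtThree) (h75 : WAllCornerX7FiveLe)
    (hK6 : BSDpOnClassX9) (hX10b : X10.BSDpOnClassX10b) (hX11a : X11a.Target)
    (hF3 : WAllCornerFInertBadAtThree) (hF5 : WAllCornerFInertBadFiveLe)
    (hF2 : WAllCornerFTwo) (hFr : WAllCornerFRamified)
    (hW : sha_dvd_analyticSha)
    (hSk : Skinner2016.thmC_padicValRat_bsd_rank_zero)
    (hBCS : BurungaleCastellaSkinner2025.cor131_padicValRat_bsd_rank_le_one)
    (hJSW : JetchevSkinnerWan2017.thm121_padicValRat_bsd_rank_one)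
    (hCGS : CastellaGrossiSkinner2025.thmD_padicValRat_bsd_rank_le_one)
    (hGV : GreenbergVatsal2000.thm13_charIdeal_eq_of_gvPar) (hGr : greenberg_charValue_rankZero)
    (hmodP : nonempty_modularParametrizationData)
    (hWa : waldspurger_exists_heegnerField_twist_ne_zero)
    (hMM : murtyMurty_exists_heegnerField_twist_simpleZero)
    (hGZ : ∀ (N : ℕ) [NeZero N] (W : WeierstrassCurve ℚ) (K : Type) [Field K] [NumberField K],
      gross_zagier N W K)
    (hKo : ∀ (N : ℕ) [NeZero N] (W : WeierstrassCurve ℚ) (K : Type) [Field K] [NumberField K],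
      kolyvagin N W K)
    (hCM : bsdTriple_of_hasCM_of_L_one_ne_zero) (hKob : Kobayashi2013.cor14_bsdp_of_cm_rank_one)
    (hYZ : YanZhu2026.thm415_padicValRat_bsd_rank_le_one)
    (hLLT : LiLiuTian2024.thm11_bsdp_of_cm_rank_one) : WAll :=
  wAll_of_cellSliceLeaves_primaryGZ h5 hM3 hG3 hT3 (wAllExclAddWild_iff_ranks.mpr ⟨hW0, hW1⟩) h50 h51
    hK2a hK2b hK5 hK3 h73 h75 hK6 hX10b hX11a hF3 hF5 hF2 hFr hW hSk hBCS hJSW hCGS hGV hGr hmodP hWa hMM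
    hGZ hKo hCM hKob hYZ hLLT

/-- **THE FULL BSD FORMULA FOR EVERY `E/ℚ` OF ANALYTIC RANK `≤ 1`** with the wild cell split by
rank: FIFTEEN named facts and ONE sign binder `hL0`.
[cite: GrossZagier1986, Thm. V.(2.1) (p. 311) and V.§2 (pp. 312–313)]
[cite: Darmon2004, Thm. 3.22 and §3.9] -/
theorem wAllFormula_of_cellRankSliceLeaves_primaryGZ (h5 : NonCMAtTwo)
    (hM3 : WAllExclAddPotMultAtThree) (hG3 : WAllExclAddPotOrdAtThree)
    (hT3 : WAllExclAddTameSSAtThree) (hW0 : WAllExclAddWildRankZero) (hW1 : WAllExclAddWildRankOne)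
    (h50 : WAllExclAdditiveFiveLeRankZero) (h51 : WAllExclAdditiveFiveLeRankOne)
    (hK2a : X11b.MultiplicativeRankOne) (hK2b : X11b.MultiplicativeRankOneAtThree)
    (hK5 : Eisenstein.EisensteinPrimes) (hK3 : Supersingular.SignedSupersingular)
    (h73 : WAllCornerX7AtThree) (h75 : WAllCornerX7FiveLe)
    (hK6 : BSDpOnClassX9) (hX10b : X10.BSDpOnClassX10b) (hX11a : X11a.Target)
    (hF3 : WAllCornerFInertBadAtThree) (hF5 : WAllCornerFInertBadFiveLe)
    (hF2 : WAllCornerFTwo) (hFr : WAllCornerFRamified)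
    (hW : sha_dvd_analyticSha)
    (hSk : Skinner2016.thmC_padicValRat_bsd_rank_zero)
    (hBCS : BurungaleCastellaSkinner2025.cor131_padicValRat_bsd_rank_le_one)
    (hJSW : JetchevSkinnerWan2017.thm121_padicValRat_bsd_rank_one)
    (hCGS : CastellaGrossiSkinner2025.thmD_padicValRat_bsd_rank_le_one)
    (hGV : GreenbergVatsal2000.thm13_charIdeal_eq_of_gvPar) (hGr : greenberg_charValue_rankZero)
    (hmodP : nonempty_modularParametrizationData)
    (hWa : waldspurger_exists_heegnerField_twist_ne_zero)
    (hMM : murtyMurty_exists_heegnerField_twist_simpleZero)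
    (hGZ : ∀ (N : ℕ) [NeZero N] (W : WeierstrassCurve ℚ) (K : Type) [Field K] [NumberField K],
      gross_zagier N W K)
    (hKo : ∀ (N : ℕ) [NeZero N] (W : WeierstrassCurve ℚ) (K : Type) [Field K] [NumberField K],
      kolyvagin N W K)
    (hCM : bsdTriple_of_hasCM_of_L_one_ne_zero) (hKob : Kobayashi2013.cor14_bsdp_of_cm_rank_one)
    (hYZ : YanZhu2026.thm415_padicValRat_bsd_rank_le_one)
    (hLLT : LiLiuTian2024.thm11_bsdp_of_cm_rank_one)
    (hL0 : re_entireLFunction_one_nonneg) : WAllFormula :=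
  wAllFormula_of_wAll_oneSign hmodP hL0 hWa hGZ
    (wAll_of_cellRankSliceLeaves_primaryGZ h5 hM3 hG3 hT3 hW0 hW1 h50 h51 hK2a hK2b hK5 hK3 h73 h75 hK6
      hX10b hX11a hF3 hF5 hF2 hFr hW hSk hBCS hJSW hCGS hGV hGr hmodP hWa hMM hGZ hKo hCM hKob hYZ hLLT)

end Summit.BirchSwinnertonDyer.Rank1Residual.WAll

end
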